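import Summits.QuantumFields.YangMills.Theorems.VirialFluxGapFixFrameStd
import Summits.QuantumFields.YangMills.Theorems.VirialFluxGapCentralZeroModeCoord
import HarnessLib

/-!
# Route `VirialFluxGap` (YangMills): the central zero-mode field in the STANDARD `X_fix` frame `fixFrameStd` (half-Pauli, slot norms ≤ 1)

Brick (C1) of the central charts for ⟨stmt-QuantumFields-24141⟩.  After fcl-p3's interface warning (2026-08-31T00:19Z: the master estimates want slot
norms `≤ 1`) the cell's preferred frame family on `X_fix` is w2's ✓`fixFrameStd` (= fcl-p3's `stdFrame` at the `X_fix` variables) rather than the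
`zUnit` family `fixFrame`.  The zero-mode DIRECTION `Y_z(P)` of ✓`VirialFluxGapCentralZeroModeCoord` is frame-free; this file gives its coordinates in
`fixFrameStd` (`zeroModeCoordStd σ σ₄ P := fixCoord (Y_z P)`, one plumbing def) and transports the results:

* `zeroModeDir_conjTranspose` ∕ `_trace` ∕ `_tree` — `Y_z(P)` is skew-Hermitian, traceless and vanishes on the slice-0 tree links;
* ★ `dirOf_fixFrameStd_zeroModeCoordStd` — `dirOf fixFrameStd (u_z^std P) = Y_z(P) = dirOf fixFrame (u_z P)` (✓`dirOf_fixFrameStd_fixCoord`);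
* ★★★ `cone_euler_fixFrameStd` ∕ `cone_euler_centralProj_std` — (E1) on the central family ∕ at `π_C P`, verbatim in the standard letters.

HONEST FRAMING: letters only; ⟨24141⟩ stays OPEN; the Yang–Mills mass gap is NOT proved; no summit is proved by a line.  One plumbing `def`, theorems
otherwise; 0 `sorry`, standard axioms.  Width seat `ym-line-sfw-p2-w3` g58 (cell ym-idea-1, free hands), `--supports stmt-QuantumFields-24141`.
References: [cite: CosteEtAl1985]; [folklore].
-/

set_option autoImplicit false

noncomputable section

open scoped Matrix Quaternion BigOperators
open Literature.MathematicalPhysics.QuantumFieldTheory hiding SU2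
open Literature.MathematicalPhysics.QuantumLattice

namespace Summit.QuantumFields.YangMills.Theorems.VirialFluxGap.FrameDerivative

open Summit.QuantumFields.YangMills.Theorems.FemtoTransferGap
open Summit.QuantumFields.YangMills.Theorems.FemtoTransferGap.TT
open Summit.QuantumFields.YangMills.Theorems.FemtoTransferGap.TwoLattice.Flat (combFlat)
open Summit.QuantumFields.YangMills.Theorems.VirialFluxGap.RingDeficit
open Summit.QuantumFields.YangMills.Theorems.VirialFluxGap.FrameHessian
open Summit.QuantumFields.YangMills.Theorems.VirialFluxGap.FixFrame

variable {L : ℕ} [NeZero L]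

/-! ## §1 The zero-mode direction is an admissible `X_fix` assignment -/

/-- The zero-mode direction is skew-Hermitian at every variable. [folklore] -/
theorem zeroModeDir_conjTranspose (σ : Fin 3 → ℝ) (σ₄ : ℝ) (P : (Fin (2 * L - 1 + 1) → GaugeConfig 3 L SU2) × (Site 3 L → SU2))
    (w : (Fin (2 * L - 1 + 1) × Edge 3 L) ⊕ Site 3 L) :
    (dirOf (fixFrame (L := L)) (zeroModeCoord L σ σ₄ P) w)ᴴ = -dirOf (fixFrame (L := L)) (zeroModeCoord L σ σ₄ P) w :=
  dirOf_conjTranspose fixFrame_conjTranspose _ w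

/-- The zero-mode direction is traceless at every variable. [folklore] -/
theorem zeroModeDir_trace (σ : Fin 3 → ℝ) (σ₄ : ℝ) (P : (Fin (2 * L - 1 + 1) → GaugeConfig 3 L SU2) × (Site 3 L → SU2))
    (w : (Fin (2 * L - 1 + 1) × Edge 3 L) ⊕ Site 3 L) :
    (dirOf (fixFrame (L := L)) (zeroModeCoord L σ σ₄ P) w).trace = 0 :=
  dirOf_trace fixFrame_trace _ w

/-- The zero-mode direction vanishes on the tree links of slice `0`. [folklore] -/
theorem zeroModeDir_tree (σ : Fin 3 → ℝ) (σ₄ : ℝ) (P : (Fin (2 * L - 1 + 1) → GaugeConfig 3 L SU2) × (Site 3 L → SU2))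
    (e : Edge 3 L) (he : treeEdge e = true) :
    dirOf (fixFrame (L := L)) (zeroModeCoord L σ σ₄ P) (Sum.inl (0, e)) = 0 :=
  dirOf_fixFrame_tree _ he

/-! ## §2 Standard coordinates -/

/-- The zero-mode coordinate vector in the STANDARD frame family `fixFrameStd`: the `fixCoord` of the zero-mode direction. [cite: CosteEtAl1985] -/
def zeroModeCoordStd (L : ℕ) [NeZero L] (σ : Fin 3 → ℝ) (σ₄ : ℝ) (P : (Fin (2 * L - 1 + 1) → GaugeConfig 3 L SU2) × (Site 3 L → SU2)) :
    FixVar L × Fin 3 → ℝ :=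
  fixCoord (dirOf (fixFrame (L := L)) (zeroModeCoord L σ σ₄ P))

/-- ★ **Same direction in the standard letters**: `dirOf fixFrameStd (u_z^std P) = dirOf fixFrame (u_z P)`. [folklore] -/
theorem dirOf_fixFrameStd_zeroModeCoordStd (σ : Fin 3 → ℝ) (σ₄ : ℝ) (P : (Fin (2 * L - 1 + 1) → GaugeConfig 3 L SU2) × (Site 3 L → SU2)) :
    dirOf (fixFrameStd (L := L)) (zeroModeCoordStd L σ σ₄ P) = dirOf (fixFrame (L := L)) (zeroModeCoord L σ σ₄ P) :=
  dirOf_fixFrameStd_fixCoord (zeroModeDir_conjTranspose σ σ₄ P) (zeroModeDir_trace σ σ₄ P) (zeroModeDir_tree σ σ₄ P)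

/-! ## §3 (E1) in the standard letters -/

/-- ★★★ **(E1) on the central comb-constant family, standard letters.** [cite: CosteEtAl1985] -/
theorem cone_euler_fixFrameStd (h : Fin 3 → SU2) (q : SU2) (σ : Fin 3 → ℝ) (σ₄ ε : ℝ)
    (hre : ∀ k, 1 - ε ≤ σ k * (su2Quat (h k)).re) (hre₄ : 1 - ε ≤ σ₄ * (su2Quat q).re) :
    2 * (1 - ε) * ringDeficit L (fun _ => false)
        ((fun _ : Fin (2 * L - 1 + 1) => combFlat (L := L) h, fun _ : Site 3 L => q) :
          (Fin (2 * L - 1 + 1) → GaugeConfig 3 L SU2) × (Site 3 L → SU2)) ≤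
      frameD (dirOf (fixFrameStd (L := L)) (zeroModeCoordStd L σ σ₄
          ((fun _ : Fin (2 * L - 1 + 1) => combFlat (L := L) h, fun _ : Site 3 L => q) :
            (Fin (2 * L - 1 + 1) → GaugeConfig 3 L SU2) × (Site 3 L → SU2)))) (ringPoly L)
        (ringCoord L (((fun _ : Fin (2 * L - 1 + 1) => combFlat (L := L) h, fun _ : Site 3 L => q) :
          (Fin (2 * L - 1 + 1) → GaugeConfig 3 L SU2) × (Site 3 L → SU2)))) := by
  rw [dirOf_fixFrameStd_zeroModeCoordStd]
  exact cone_euler_fixFrame h q σ σ₄ ε hre hre₄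

end Summit.QuantumFields.YangMills.Theorems.VirialFluxGap.FrameDerivative

end
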